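import Summits.AtomisticToContinuum.FouriersLaw.Theorems.HiddenChargeMazurNoOddChargeGibbsBounds

/-!
# Sub-extensive block overlap (stub S2b of crux `DressedCharge`) — moments of every order

Helper file for stub `stub_blockOverlap` (S2b) of line `birth` of the crux
`Summit.AtomisticToContinuum.FouriersLaw.Theses.HiddenChargeMazur.DressedCharge`
(item stmt-AtomisticToContinuum-13509, route `HiddenChargeMazur`); a `--supports` file, it closes
no item by itself.

Statics of the Gibbs weight `ρ = e^{-H/T}` of `pinnedChain ω₂ lam β γ` (`ω₂, lam, T > 0`, `β ≥ 0`),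
uniform in the chain length `N`, for ARBITRARY even moments (the `NoOddCharge` files stop at the
sixteenth): iterating the moment chain `lam ∑_i ∫ q_i^{2m+4} ρ ≤ (2m+1) T ∑_i ∫ q_i^{2m} ρ`
(`NoOddCharge.pinnedChain_sum_integral_position_pow_step`) from `m = 0` gives the EXTENSIVE bound
`∑_i ∫ q_i^{4j} ρ ≤ C_j N ∫ ρ`, hence `E_μ[q_i^{2j}] ≤ √(C_j) √N` by one Cauchy–Schwarz against `1`;
momenta are exactly Gaussian, `E_μ[p_i^{2j}] = (2j-1)!! T^j`.  The second half is pure algebra: a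
real multivariate polynomial is dominated by `(∑ |coeff|) (1 + ∑_s |v_s|)^deg`, and its square by a
constant times `1 + ∑_s v_s^{2 deg}` (power-mean inequality), which is what makes the second Gibbs
moment of a polynomial block observable `O(√N)`.  Registered sub-goal proved here:
`stub_blockOverlap_moments`; plus two elementary estimates used by the assembly (energy domination of
the block coordinates, and `E √(N√N) ≤ c N` for large `N`).
-/

noncomputable section

open MeasureTheory
open scoped BigOperators
open Literature.MathematicalPhysics.KineticTheory.HeatConduction
open Summit.AtomisticToContinuum.FouriersLaw.Theorems.SubdiffusiveBondHeat
open Summit.AtomisticToContinuum.FouriersLaw.Theorems.LightConeBondHeat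
open Summit.AtomisticToContinuum.FouriersLaw.Theorems.NoOddCharge

namespace Summit.AtomisticToContinuum.FouriersLaw.Theorems.DressedCharge

variable {ω₂ lam β : ℝ}

/-! ### Extensive position moments of every order `4j` -/

/-- **Extensive moments of order `4j`.** For every `j` there is `C ≥ 0` (depending on `T, lam, j`
only) with `∑_i ∫ q_i^{4j} e^{-H/T} ≤ C · N · ∫ e^{-H/T}` for EVERY chain length `N`
(induction on `j` along the moment chain `pinnedChain_sum_integral_position_pow_step` with `m = 2j`).
[folklore] -/
theorem pinnedChain_sum_integral_position_pow_four_mul_le (hω : 0 < ω₂) (hl : 0 < lam) (hβ : 0 ≤ β)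
    (γ : ℝ) {T : ℝ} (hT : 0 < T) (j : ℕ) :
    ∃ C : ℝ, 0 ≤ C ∧ ∀ N : ℕ,
      ∑ i : Fin N, ∫ x, x.1 i ^ (4 * j) * (pinnedChain ω₂ lam β γ).gibbsDensity N T x ≤
        C * N * ∫ x, (pinnedChain ω₂ lam β γ).gibbsDensity N T x := by
  induction j with
  | zero =>
    refine ⟨1, zero_le_one, fun N => ?_⟩
    simp
  | succ j ih =>
    obtain ⟨C, hC0, hC⟩ := ih
    refine ⟨(4 * j + 1) * T / lam * C, by positivity, fun N => ?_⟩
    have hstep := pinnedChain_sum_integral_position_pow_step hω hl hβ γ N hT (2 * j)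
    have e1 : 2 * (2 * j) + 4 = 4 * (j + 1) := by ring
    have e2 : 2 * (2 * j) = 4 * j := by ring
    rw [e1, e2] at hstep
    push_cast at hstep
    have hN := hC N
    have hZ : 0 ≤ ∫ x, (pinnedChain ω₂ lam β γ).gibbsDensity N T x :=
      integral_nonneg fun x => ((pinnedChain ω₂ lam β γ).gibbsDensity_pos N T x).le
    rw [div_mul_eq_mul_div, div_mul_eq_mul_div, div_mul_eq_mul_div, le_div_iff₀ hl]
    calc (∑ i : Fin N, ∫ x, x.1 i ^ (4 * (j + 1)) * (pinnedChain ω₂ lam β γ).gibbsDensity N T x) * lam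
        = lam * ∑ i : Fin N, ∫ x, x.1 i ^ (4 * (j + 1)) * (pinnedChain ω₂ lam β γ).gibbsDensity N T x :=
          mul_comm _ _
      _ ≤ (2 * (2 * (j : ℝ)) + 1) * T *
            ∑ i : Fin N, ∫ x, x.1 i ^ (4 * j) * (pinnedChain ω₂ lam β γ).gibbsDensity N T x := hstep
      _ ≤ (2 * (2 * (j : ℝ)) + 1) * T * (C * N * ∫ x, (pinnedChain ω₂ lam β γ).gibbsDensity N T x) :=
          mul_le_mul_of_nonneg_left hN (by positivity)
      _ = (4 * j + 1) * T * C * N * ∫ x, (pinnedChain ω₂ lam β γ).gibbsDensity N T x := by ring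

/-- **Single-site even moments are `O(√N)`.** For every `j` there is `C ≥ 0` (depending on
`T, lam, j` only) with `E_μ[q_i^{2j}] ≤ C √N` for every `N` and every site `i` (the extensive bound
`E_μ[q_i^{4j}] ≤ C' N` and one Cauchy–Schwarz against `1`). [folklore] -/
theorem pinnedChain_gibbs_position_pow_le_sqrt (hω : 0 < ω₂) (hl : 0 < lam) (hβ : 0 ≤ β) (γ : ℝ)
    {T : ℝ} (hT : 0 < T) (j : ℕ) :
    ∃ C : ℝ, 0 ≤ C ∧ ∀ (N : ℕ) (i : Fin N),
      ∫ x, x.1 i ^ (2 * j) ∂((pinnedChain ω₂ lam β γ).gibbsMeasure N T) ≤ C * Real.sqrt N := by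
  obtain ⟨C, hC0, hC⟩ := pinnedChain_sum_integral_position_pow_four_mul_le hω hl hβ γ hT j
  refine ⟨Real.sqrt C, Real.sqrt_nonneg _, fun N i => ?_⟩
  set μ := (pinnedChain ω₂ lam β γ).gibbsMeasure N T with hμ
  haveI := pinnedChain_isProbabilityMeasure_gibbsMeasure hω hl.le hβ γ N hT
  have h4 : ∫ x, x.1 i ^ (4 * j) ∂μ ≤ C * N := by
    refine pinnedChain_integral_gibbsMeasure_le_of hω hl.le hβ γ N hT ?_
    have hsingle : ∫ x, x.1 i ^ (4 * j) * (pinnedChain ω₂ lam β γ).gibbsDensity N T x ≤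
        ∑ i' : Fin N, ∫ x, x.1 i' ^ (4 * j) * (pinnedChain ω₂ lam β γ).gibbsDensity N T x :=
      Finset.single_le_sum
        (f := fun i' : Fin N => ∫ x, x.1 i' ^ (4 * j) * (pinnedChain ω₂ lam β γ).gibbsDensity N T x)
        (fun i' _ => integral_nonneg fun x => mul_nonneg
          (Even.pow_nonneg (⟨2 * j, by ring⟩ : Even (4 * j)) _)
          ((pinnedChain ω₂ lam β γ).gibbsDensity_pos N T x).le) (Finset.mem_univ i)
    exact hsingle.trans (hC N)
  have hI : ∀ n : ℕ, Integrable (fun x : PhaseSpace N => x.1 i ^ n) μ := fun n =>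
    (pinnedChain ω₂ lam β γ).integrable_gibbsMeasure
      (pinnedChain_integrable_position_pow_mul_gibbsDensity' hω hl hβ γ N hT i n)
  have hcs := sq_integral_mul_le μ (f := fun x => x.1 i ^ (2 * j)) (g := fun _ => (1:ℝ))
    ((hI (4 * j)).congr (Filter.Eventually.of_forall fun x => by simp only; ring)) (by simp)
    ((hI (2 * j)).congr (Filter.Eventually.of_forall fun x => by simp))
  simp only [mul_one, one_pow, integral_const, smul_eq_mul, Measure.real, measure_univ,
    ENNReal.toReal_one] at hcs
  have h4' : ∫ x, (x.1 i ^ (2 * j)) ^ 2 ∂μ ≤ C * N := by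
    refine le_trans (le_of_eq ?_) h4
    exact integral_congr_ae (Filter.Eventually.of_forall fun x => by simp only; ring)
  rw [← Real.sqrt_mul hC0]
  apply Real.le_sqrt_of_sq_le
  linarith

/-! ### Gaussian momentum moments of every even order -/

/-- **Gaussian momenta.** For every `j` there is `M ≥ 0` (depending on `T, j` only; in fact
`M = (2j-1)!! T^j`) with `∫ p_i^{2j} e^{-H/T} = M ∫ e^{-H/T}` for every `N` and every site `i`
(induction on `j` with `pinnedChain_integral_momentum_pow_add_two'`). [folklore] -/
theorem pinnedChain_integral_momentum_pow_two_mul_eq (hω : 0 < ω₂) (hl : 0 ≤ lam) (hβ : 0 ≤ β)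
    (γ : ℝ) {T : ℝ} (hT : 0 < T) (j : ℕ) :
    ∃ M : ℝ, 0 ≤ M ∧ ∀ (N : ℕ) (i : Fin N),
      ∫ x, x.2 i ^ (2 * j) * (pinnedChain ω₂ lam β γ).gibbsDensity N T x =
        M * ∫ x, (pinnedChain ω₂ lam β γ).gibbsDensity N T x := by
  induction j with
  | zero => exact ⟨1, zero_le_one, fun N i => by simp⟩
  | succ j ih =>
    obtain ⟨M, hM0, hM⟩ := ih
    refine ⟨T * (2 * j + 1) * M, by positivity, fun N i => ?_⟩
    have h := pinnedChain_integral_momentum_pow_add_two' hω hl hβ γ N hT i (2 * j)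
    rw [show 2 * (j + 1) = 2 * j + 2 by ring, h, hM N i]
    push_cast
    ring

/-- `E_μ[p_i^{2j}] ≤ M` with the constant of `pinnedChain_integral_momentum_pow_two_mul_eq`
(uniformly in `N` and `i`). [folklore] -/
theorem pinnedChain_gibbs_momentum_pow_le (hω : 0 < ω₂) (hl : 0 ≤ lam) (hβ : 0 ≤ β) (γ : ℝ)
    {T : ℝ} (hT : 0 < T) (j : ℕ) :
    ∃ M : ℝ, 0 ≤ M ∧ ∀ (N : ℕ) (i : Fin N),
      ∫ x, x.2 i ^ (2 * j) ∂((pinnedChain ω₂ lam β γ).gibbsMeasure N T) ≤ M := by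
  obtain ⟨M, hM0, hM⟩ := pinnedChain_integral_momentum_pow_two_mul_eq hω hl hβ γ hT j
  exact ⟨M, hM0, fun N i => pinnedChain_integral_gibbsMeasure_le_of hω hl hβ γ N hT (hM N i).le⟩

/-! ### Domination of real multivariate polynomials -/

/-- **Coefficient bound.** `|p(v)| ≤ (∑_d |coeff_d p|) · (1 + ∑_s |v_s|)^{deg p}` for a real
polynomial in finitely many variables (each monomial `∏_s v_s^{d_s}` is bounded by `S^{|d|} ≤ S^{deg}`
with `S = 1 + ∑_s |v_s| ≥ 1`). [folklore] -/
theorem abs_eval_le_sum_abs_coeff_mul_pow {σ : Type*} [Fintype σ] (p : MvPolynomial σ ℝ) (v : σ → ℝ) :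
    |MvPolynomial.eval v p| ≤
      (∑ d ∈ p.support, |p.coeff d|) * (1 + ∑ s, |v s|) ^ p.totalDegree := by
  set S : ℝ := 1 + ∑ s, |v s| with hS
  have hS1 : 1 ≤ S := le_add_of_nonneg_right (Finset.sum_nonneg fun s _ => abs_nonneg _)
  have hvS : ∀ s, |v s| ≤ S := fun s => by
    have := Finset.single_le_sum (f := fun s => |v s|) (fun s _ => abs_nonneg _) (Finset.mem_univ s)
    linarith
  rw [MvPolynomial.eval_eq', Finset.sum_mul]
  refine (Finset.abs_sum_le_sum_abs _ _).trans (Finset.sum_le_sum fun d hd => ?_)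
  rw [abs_mul, Finset.abs_prod]
  refine mul_le_mul_of_nonneg_left ?_ (abs_nonneg _)
  calc ∏ s, |v s ^ d s| = ∏ s, |v s| ^ d s := by simp only [abs_pow]
    _ ≤ ∏ s, S ^ d s := Finset.prod_le_prod (fun s _ => by positivity)
        fun s _ => pow_le_pow_left₀ (abs_nonneg _) (hvS s) _
    _ = S ^ ∑ s, d s := Finset.prod_pow_eq_pow_sum _ _ _
    _ ≤ S ^ p.totalDegree := pow_le_pow_right₀ hS1 (by
        have := MvPolynomial.le_totalDegree hd
        rwa [Finsupp.sum_fintype _ _ (fun _ => rfl)] at this)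

/-- **Power-mean inequality** `(1 + ∑_s x_s)^m ≤ (|σ| + 1)^m (1 + ∑_s x_s^m)` for `x ≥ 0` (Jensen for
`t ↦ t^m` on the `|σ| + 1` numbers `1, x_s`; Mathlib's `pow_sum_le_card_mul_sum_pow`). [folklore] -/
theorem one_add_sum_pow_le {σ : Type*} [Fintype σ] (x : σ → ℝ) (hx : ∀ s, 0 ≤ x s) (m : ℕ) :
    (1 + ∑ s, x s) ^ m ≤ ((Fintype.card σ : ℝ) + 1) ^ m * (1 + ∑ s, (x s) ^ m) := by
  cases m with
  | zero =>
    simp only [pow_zero, Finset.sum_const, Finset.card_univ, nsmul_eq_mul, mul_one, one_mul]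
    have : (0 : ℝ) ≤ Fintype.card σ := Nat.cast_nonneg _
    linarith
  | succ m =>
    set f : Option σ → ℝ := fun o => o.elim 1 x with hf
    have hf0 : ∀ o ∈ (Finset.univ : Finset (Option σ)), 0 ≤ f o := by
      rintro (_ | s) _
      · exact zero_le_one
      · exact hx s
    have h := pow_sum_le_card_mul_sum_pow hf0 m
    rw [Fintype.sum_option, Fintype.sum_option, Finset.card_univ, Fintype.card_option] at h
    simp only [hf, Option.elim_none, Option.elim_some, one_pow, Nat.cast_add, Nat.cast_one] at h
    refine h.trans (mul_le_mul_of_nonneg_right ?_ ?_)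
    · exact pow_le_pow_right₀ (by linarith [(Nat.cast_nonneg _ : (0 : ℝ) ≤ Fintype.card σ)])
        (Nat.le_succ m)
    · exact add_nonneg zero_le_one (Finset.sum_nonneg fun s _ => pow_nonneg (hx s) _)

/-- **Square of a polynomial against single-variable powers.**
`p(v)² ≤ ((∑_d |coeff_d p|) (|σ|+1)^{deg p})² · (1 + ∑_s v_s^{2 deg p})`. [folklore] -/
theorem eval_sq_le_mul_one_add_sum_pow {σ : Type*} [Fintype σ] (p : MvPolynomial σ ℝ) (v : σ → ℝ) :
    (MvPolynomial.eval v p) ^ 2 ≤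
      ((∑ d ∈ p.support, |p.coeff d|) * ((Fintype.card σ : ℝ) + 1) ^ p.totalDegree) ^ 2 *
        (1 + ∑ s, (v s) ^ (2 * p.totalDegree)) := by
  have h1 := abs_eval_le_sum_abs_coeff_mul_pow p v
  have h2 := one_add_sum_pow_le (fun s => |v s|) (fun s => abs_nonneg _) (2 * p.totalDegree)
  simp only [Even.pow_abs ⟨p.totalDegree, two_mul p.totalDegree⟩] at h2
  have hA : 0 ≤ ∑ d ∈ p.support, |p.coeff d| := Finset.sum_nonneg fun d _ => abs_nonneg _
  have hS : 0 ≤ 1 + ∑ s, |v s| := add_nonneg zero_le_one (Finset.sum_nonneg fun s _ => abs_nonneg _)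
  calc (MvPolynomial.eval v p) ^ 2 = |MvPolynomial.eval v p| ^ 2 := (sq_abs _).symm
    _ ≤ ((∑ d ∈ p.support, |p.coeff d|) * (1 + ∑ s, |v s|) ^ p.totalDegree) ^ 2 :=
        pow_le_pow_left₀ (abs_nonneg _) h1 2
    _ = (∑ d ∈ p.support, |p.coeff d|) ^ 2 * (1 + ∑ s, |v s|) ^ (2 * p.totalDegree) := by ring
    _ ≤ (∑ d ∈ p.support, |p.coeff d|) ^ 2 *
          (((Fintype.card σ : ℝ) + 1) ^ (2 * p.totalDegree) * (1 + ∑ s, (v s) ^ (2 * p.totalDegree))) :=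
        mul_le_mul_of_nonneg_left h2 (by positivity)
    _ = _ := by ring

/-! ### Registered sub-goal of stub S2b: moments -/

/-- **Registered helper stub `stub_blockOverlap_moments` of S2b.** For the pinned anharmonic chain
(`ω₂, lam, T > 0`, `β ≥ 0`) and every order `2j`: single-site Gibbs moments are `O(√N)` for positions
and `O(1)` for momenta, uniformly in the site and in the chain length `N`. [folklore] -/
theorem stub_blockOverlap_moments :
    ∀ ω₂ lam β γ T : ℝ, 0 < ω₂ → 0 < lam → 0 ≤ β → 0 < T → ∀ j : ℕ,
      (∃ C : ℝ, 0 ≤ C ∧ ∀ (N : ℕ) (i : Fin N),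
        ∫ x, x.1 i ^ (2 * j) ∂((pinnedChain ω₂ lam β γ).gibbsMeasure N T) ≤ C * Real.sqrt N) ∧
      (∃ M : ℝ, 0 ≤ M ∧ ∀ (N : ℕ) (i : Fin N),
        ∫ x, x.2 i ^ (2 * j) ∂((pinnedChain ω₂ lam β γ).gibbsMeasure N T) ≤ M) := by
  intro ω₂ lam β γ T hω hl hβ hT j
  exact ⟨pinnedChain_gibbs_position_pow_le_sqrt hω hl hβ γ hT j,
    pinnedChain_gibbs_momentum_pow_le hω hl.le hβ γ hT j⟩

/-! ### Two elementary estimates used by the assembly -/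

/-- **Coordinates of a block are energy-dominated**: every variable fed into `K` (a position, a
momentum, or a padding zero) is bounded by `(5 + 4/lam)(1+H)²`. [folklore] -/
theorem pinnedChain_abs_blockVar_le (hω : 0 ≤ ω₂) (hl : 0 < lam) (hβ : 0 ≤ β) (γ : ℝ) (N : ℕ) {L : ℕ}
    (e : Fin L → ℕ) (z : PhaseSpace N) (s : Fin L ⊕ Fin L) :
    |Sum.elim (fun i : Fin L => (if h : e i < N then (z.1 ⟨e i, h⟩, z.2 ⟨e i, h⟩) else ((0:ℝ), (0:ℝ))).1)
        (fun i : Fin L => (if h : e i < N then (z.1 ⟨e i, h⟩, z.2 ⟨e i, h⟩) else ((0:ℝ), (0:ℝ))).2) s| ≤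
      (5 + 4 / lam) * (1 + (pinnedChain ω₂ lam β γ).hamiltonian N z) ^ 2 := by
  have hH0 := pinnedChain_hamiltonian_nonneg hω hl.le hβ γ N z
  set Hm := (pinnedChain ω₂ lam β γ).hamiltonian N z with hHm
  have h1 : (1:ℝ) ≤ (1 + Hm) ^ 2 := one_le_pow₀ (by linarith)
  have h0 : (0:ℝ) ≤ (5 + 4 / lam) * (1 + Hm) ^ 2 := by positivity
  rcases s with i | i
  · simp only [Sum.elim_inl]
    by_cases h : e i < N
    · simp only [dif_pos h]
      have hq := pinnedChain_abs_position_pow_le_pow hω hl hβ γ N z ⟨e i, h⟩ 1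
      rw [pow_one, pow_one, pow_one] at hq
      have h4l : (0:ℝ) ≤ 4 / lam := by positivity
      calc |z.1 ⟨e i, h⟩| ≤ (1 + 4 / lam) * (1 + Hm) := hq
        _ ≤ (1 + 4 / lam) * (1 + Hm) ^ 2 := by
            refine mul_le_mul_of_nonneg_left ?_ (by positivity)
            nlinarith
        _ ≤ (5 + 4 / lam) * (1 + Hm) ^ 2 := by nlinarith
    · simp only [dif_neg h, abs_zero]
      exact h0
  · simp only [Sum.elim_inr]
    by_cases h : e i < N
    · simp only [dif_pos h]
      have hp := pinnedChain_abs_momentum_pow_le_pow hω hl.le hβ γ N z ⟨e i, h⟩ 1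
      rw [pow_one, pow_one, mul_one] at hp
      have h4l : (0:ℝ) ≤ 4 / lam := by positivity
      calc |z.2 ⟨e i, h⟩| ≤ 4 * (1 + Hm) ^ 2 := hp
        _ ≤ (5 + 4 / lam) * (1 + Hm) ^ 2 := by nlinarith
    · simp only [dif_neg h, abs_zero]
      exact h0

/-- **Eventually `≤ c N`.** The elementary step: if `0 < c` and `N ≥ ⌈(E²/c²)²⌉₊ + 1` then
`E √(N √N) ≤ c N` (compare squares: `E² ≤ c² √N`). [folklore] -/
theorem mul_sqrt_mul_sqrt_le_of_le {E c : ℝ} (hc : 0 < c) {N : ℕ}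
    (hN : ⌈(E ^ 2 / c ^ 2) ^ 2⌉₊ + 1 ≤ N) :
    E * Real.sqrt (N * Real.sqrt N) ≤ c * N := by
  have hN0 : (0:ℝ) ≤ N := Nat.cast_nonneg _
  have hNreal : (E ^ 2 / c ^ 2) ^ 2 ≤ (N : ℝ) :=
    (Nat.le_ceil _).trans (by exact_mod_cast (by omega : ⌈(E ^ 2 / c ^ 2) ^ 2⌉₊ ≤ N))
  have hx0 : 0 ≤ E ^ 2 / c ^ 2 := by positivity
  have hsq : E ^ 2 / c ^ 2 ≤ Real.sqrt N := by
    have := Real.sqrt_le_sqrt hNreal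
    rwa [Real.sqrt_sq hx0] at this
  have h1 : E ^ 2 ≤ c ^ 2 * Real.sqrt N := by
    have := mul_le_mul_of_nonneg_left hsq (sq_nonneg c)
    rwa [show c ^ 2 * (E ^ 2 / c ^ 2) = E ^ 2 by field_simp] at this
  have hcN : 0 ≤ c * N := by positivity
  refine (abs_le_of_sq_le_sq' ?_ hcN).2
  calc (E * Real.sqrt (N * Real.sqrt N)) ^ 2 = E ^ 2 * (N * Real.sqrt N) := by
        rw [mul_pow, Real.sq_sqrt (by positivity)]
    _ ≤ c ^ 2 * Real.sqrt N * (N * Real.sqrt N) := mul_le_mul_of_nonneg_right h1 (by positivity)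
    _ = c ^ 2 * N * (Real.sqrt N) ^ 2 := by ring
    _ = (c * N) ^ 2 := by rw [Real.sq_sqrt hN0]; ring

end Summit.AtomisticToContinuum.FouriersLaw.Theorems.DressedCharge

end
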